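import Mathlib
import HarnessLib
import HarnessLib.Audit
import Summits.AtomisticToContinuum.Statement
import Literature.MathematicalPhysics.StatisticalMechanics.LennardJonesClusters

/-!
Route: SurfaceTensionFirst

CLOSED (retired) 2026-08-15T13:47:15Z by operator:999:1257524 — reason: not-a-thesis: assembly does not conclude the sub-problem Statement — note: D-0027 §2.1 audit (human 2026-08-15: routes that do not decide the summit are removed): the assembly concludes `Literature.MathematicalPhysics.StatisticalMechanics.Crystallization`, not the sub-problem statement; a NEW conforming route may be opened from the same idea (generated `closes : … → _root_. The file is kept as the record of this route; refuted decls are indexed as negative knowledge (`ledger negatives`).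

# Route SurfaceTensionFirst — surface tension first — vacuum-adjacent sites of LJ ground states cost
c each above e* (⇒ NoFoam, σ_LJ > 0), reflection doubling now; bulk by the Benjamini–Schramm crux

It suffices to show X = ExposedSitesCost ∧ StationaryMinimisersChargePeriodic (card
surface-tension-first-reflection-doubling as spine; the
infinite-volume tail is the one of card benjamini-schramm-ground-states, items shared verbatim with
route BenjaminiSchrammGroundStates).
ExposedSitesCost (SURFACE TENSION FIRST; the card's Σ4/Σ5 in configuration form): there is a void
radius r₀ such that at every observation
radius R every particle of a Lennard-Jones ground state lying within R of an empty ball of radius r₀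
(outer surface, internal voids, cracks)
costs at least c(R) > 0 above the periodic infimum e* = ⨅_Q e(Q): c·#exposed ≤ E(N) − N·e*. Since
E(N)/N → e* (shared 0626) the exposed
fraction is o(1) — this is NoFoam, the one finite-N input of the Benjamini–Schramm line — and with
the isoperimetric count #exposed ≥ c₁N^{2/3}
it is the headline σ_LJ := liminf (E(N) − Ne*)/N^{2/3} > 0 (SurfaceTensionPositive).
StationaryMinimisersChargePeriodic (shared item 2910) is
the bulk step: stationary hard-core energy-minimising laws charge one periodic pattern.
VoidWallDeficit (crux 4) is the exposed-side half of
ExposedSitesCost in the half-bond gauge and the card's Rung 2; ReflectionDoubling (Rung 1) and the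
two glue items are provable now.
Lean: `(∃ r₀ : ℝ, 0 < r₀ ∧ ∀ R : ℝ, 0 < R → ∃ c : ℝ, 0 < c ∧ ∀ (N : ℕ) (x : Fin N → EuclideanSpace ℝ
(Fin 3)), Literature.MathematicalPhysics.StatisticalMechanics.IsGroundState
Literature.MathematicalPhysics.StatisticalMechanics.lennardJones x → c * (Nat.card {i : Fin N // ∃ p
: EuclideanSpace ℝ (Fin 3), dist p (x i) ≤ R ∧ ∀ j : Fin N, r₀ ≤ dist p (x j)} : ℝ) ≤
Literature.MathematicalPhysics.StatisticalMechanics.groundStateEnergy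
Literature.MathematicalPhysics.StatisticalMechanics.lennardJones 3 N - (N : ℝ) * (⨅ Q :
Literature.MathematicalPhysics.StatisticalMechanics.PeriodicConfiguration 3, Q.energyPerParticle
Literature.MathematicalPhysics.StatisticalMechanics.lennardJones)) ∧ (∀ δ₀ r₀ : ℝ, 0 < δ₀ → 0 < r₀ →
∀ P : MeasureTheory.Measure (MeasureTheory.Measure (EuclideanSpace ℝ (Fin 3))),
MeasureTheory.IsProbabilityMeasure P → (∀ᵐ μ ∂P, ∃ S : Set (EuclideanSpace ℝ (Fin 3)), (∀ x ∈ S, ∀ y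
∈ S, x ≠ y → δ₀ ≤ dist x y) ∧ μ = MeasureTheory.Measure.sum (fun s : S =>
MeasureTheory.Measure.dirac (s : EuclideanSpace ℝ (Fin 3)))) → (∀ᵐ μ ∂P, ∀ c : EuclideanSpace ℝ (Fin
3), ∃ y : EuclideanSpace ℝ (Fin 3), μ {y} ≠ 0 ∧ dist y c ≤ r₀) → (∀ (v : EuclideanSpace ℝ (Fin 3))
(A : Set (MeasureTheory.Measure (EuclideanSpace ℝ (Fin 3)))), MeasurableSet A → P {μ | μ.map (· + v)
∈ A} = P A) → (∫ μ, (∑' p : {p : EuclideanSpace ℝ (Fin 3) × EuclideanSpace ℝ (Fin 3) // μ {p.1} ≠ 0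
∧ μ {p.2} ≠ 0 ∧ p.1 ∈ Metric.closedBall (0 : EuclideanSpace ℝ (Fin 3)) 1 ∧ p.1 ≠ p.2},
Literature.MathematicalPhysics.StatisticalMechanics.lennardJones (dist p.1.1 p.1.2)) ∂P) = 2 * (∫ μ,
(μ (Metric.closedBall (0 : EuclideanSpace ℝ (Fin 3)) 1)).toReal ∂P) * (⨅ Q :
Literature.MathematicalPhysics.StatisticalMechanics.PeriodicConfiguration 3, Q.energyPerParticle
Literature.MathematicalPhysics.StatisticalMechanics.lennardJones) → ∃ Q :
Literature.MathematicalPhysics.StatisticalMechanics.PeriodicConfiguration 3, ∀ R ε : ℝ, 0 < R → 0 <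
ε → 0 < P {μ | ∃ v : EuclideanSpace ℝ (Fin 3), (∀ s ∈ Q.points, dist s 0 ≤ R → ∃ y : EuclideanSpace
ℝ (Fin 3), μ {y} ≠ 0 ∧ dist y (s + v) ≤ ε) ∧ (∀ y : EuclideanSpace ℝ (Fin 3), μ {y} ≠ 0 → dist y v ≤
R → ∃ s ∈ Q.points, dist y (s + v) ≤ ε)})`

## Assembly
Pure logic over the items plus two PROVED Literature facts, sorry-free in the planner's Sketch.lean
(`assembly_provable`, axioms
propext / Classical.choice / Quot.sound): ExposedCostGivesNoFoam turns ExposedSitesCost +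
CrysEnergyLimit into NoFoam;
BSLimitGlue (StationaryMinimisersChargePeriodic, NoFoam, CrysEnergyLimit) gives
GroundStatesChargePeriodic; ChargedPatternCrystallizes with
LennardJonesMinimalDistance_holds gives IsCrystallizing lennardJones 3; a ground-state sequence
exists (LennardJonesGroundStatesExist_holds), is
charged by some periodic Q, ChargedPeriodicIsOptimal makes e(Q) least, so ⨅ = e(Q)
(IsLeast.csInf_eq) and CrysEnergyLimit is the
HasPeriodicGroundStateEnergy clause; the conjunction is
Literature.MathematicalPhysics.StatisticalMechanics.Crystallization, of which the
sub-problem constant is an abbrev. VoidWallDeficit, SurfaceTensionPositive and ReflectionDoubling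
are deliberately not antecedents: the first
is the staffed exposed-side half of ExposedSitesCost (foreseen split), the other two are its
corollary and its provable rung.

Rationale: WHY THIS LINE. Every open route on this sub-problem attacks the bulk (local certificates, kissing
rigidity, stacking selection, three-cone LP,
Benjamini–Schramm limits) and each silently needs cohesion of the finite ground states: NoFoam is
crux 2912 of BenjaminiSchrammGroundStates
("not even diam = O(N^{1/3}) is in print", BlancLewin2015 §2.2), and the surface window E(N) = Ne* +
O(N^{2/3}) is consumed from above by
CrystalKissingRigidity / OneGrainWindow without a lower half. This line makes the zero-temperature
SURFACE TENSION the first theorem: a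
lower bound that is sharp at e* but equality-free and stacking-blind IN STATEMENT and prices only
vacuum-adjacent sites — the 30 %-margin
side of the margin map — logically far below LjDefectCoercivity (3505, every mismatched particle
w.r.t. a named minimiser) and KeplerBound
(3102). Imported: the add/remove/relocate-one-particle technology of cluster optimisation (Xue1997,
Blanc2004, Yuhjtman2015,
KiesslingWales2025 — there for the minimal distance, here turned into binding deficits of void-wall
sites and a bounded adatom field),
one-sided kissing / contact-number combinatorics (Bezdek2011, arXiv:1601.00145 §7, Musin
doi:10.1007/s10998-006-0033-0), the Wulff-term
programme of 2-D crystallization (HeitmannRadin1980, AuYeungFrieseckeSchmidt2012,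
FriedrichKreutz2023 — where σ > 0 is automatic because
over-coordination is impossible) and the d = 1 surface-energy theorem arXiv:1904.06169 Prop 3.4; the
bulk step is imported whole from the
Benjamini–Schramm route (AldousSteele2004 objective method, Radin1991 ground-state measures).
Reflection doubling is the quantitative form
of the two-copies strict-subadditivity trick of BlancLewin2015 §1.2 and gives the first effective
growth bound on E(N) − Ne* for faceted
clusters. Negatives index: empty at filing.

RANKED CRUXES. #2 ExposedSitesCost (crux) — (card Σ4/Σ5, configuration form, for ground states)
there is r₀ > 0 such that for every R > 0 some c > 0 satisfies, for every N and every N-particle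
Lennard-Jones ground state x in ℝ³: c·#{i : some point p with |p − x_i| ≤ R has no particle strictly
within distance r₀} ≤ E(N) − N·⨅_Q e(Q). Vacuum-adjacent particles (outer surface, internal voids
and cracks of radius ≥ r₀) each cost c above the periodic infimum; no minimiser is named, no
stability modulus and no stacking resolution appear in the statement (contrast LjDefectCoercivity
3505, KeplerBound 3102). For R < r₀ the set is empty and the statement is periodisation 0715.
[difficulty: open-problem] (why it might fail: Physically true (σ_LJ > 0) but any lower-bound method
must be exact at e* in the bulk: a stacking-blind gauge loses ηN ≫ N^{2/3} (e(fcc) − e(hcp) ≈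
1e-4·|e*|), and Z ≥ 13 over-binding sheets (slack 1–3 %) may offset the ≈ 0.17 half-bond deficit of
exposed sites.) [BlancLewin2015, Theil2006, AuYeungFrieseckeSchmidt2012, FriedrichKreutz2023,
arXiv:1904.06169, arXiv:1601.00145, Literature.Barriers.AtomisticToContinuum.TetrahedralFrustration]
#3 StationaryMinimisersChargePeriodic (crux) — (shared item stmt-AtomisticToContinuum-2910 of route
BenjaminiSchrammGroundStates, verbatim) for all δ₀, r₀ > 0 and every probability law P on counting
measures of ℝ³ that is a.s. a sum of unit Dirac masses on a δ₀-separated set, a.s. r₀-relatively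
dense, translation invariant, and energy-minimal in the Campbell form E Σ_(x ∈ μ ∩ B̄(0,1)) Σ_(y ≠
x) V_LJ(|x − y|) = 2·E μ(B̄(0,1))·⨅_Q e(Q), there is a periodic configuration Q such that for all R,
ε > 0, with positive P-probability some translate of μ is ε-matched both ways with Q on the ball of
radius R. The bulk step of this route; its finite-N input NoFoam is supplied here by
ExposedSitesCost. [difficulty: open-problem] (why it might fail: Potential-generic versions are
false (AperiodicTilingGroundStates; Radin 1986 two-species quasiperiodic minimisers; Sütő). For LJ
an amorphous/polytetrahedral or aperiodically stacked stationary law reaching e* kills it; the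
stacking half rests on Hägg domination (J₂≈−7e−5, uncertified, item 0670).) [Radin1991,
RadinSchulman1983, Radin1987, BlancLewin2015, Lewin2022, Leble2016, AldousLyons2007]
#4 VoidWallDeficit (crux) — (card Rung 2 / Σ2, the exposed half of ExposedSitesCost in the half-bond
gauge) there is γ > 0 such that in every Lennard-Jones ground state every particle x_i on the wall
of an empty open unit ball (some p with |p − x_i| ≤ 1 and |p − x_j| ≥ 1 for all j; every convex-hull
particle qualifies with p = x_i + outward unit normal) has site energy Σ_{k≠i} V_LJ(|x_i − x_k|) ≥
2·⨅_Q e(Q) + γ, i.e. binds by a uniform margin less than the bulk cohesive sum 2|e*| ≈ 1.435. The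
empty ball removes a 60° cap (≈ 3 of 12 first neighbours, ≈ 17 % of the binding, against ≤ 3 %
one-centre over-binding slack); by one-particle relocation it bounds the adatom field of every
ground state by 2|e*| − γ + 1/12 everywhere (no deep re-entrant sites; vacancy exclusion once L6/L12
numerics are certified). [difficulty: L] (why it might fail: Needs a near-sharp minimal distance in
ground states (proved 0.684 r₀ = 0.7678σ, Yuhjtman2015; conjectured 0.891, KiesslingWales2025) and a
certified cap-excluded one-centre maximum < 1.435 (estimated 1.1–1.25, never computed); volume
counting alone allows > 30 near neighbours.) [Yuhjtman2015, KiesslingWales2025, Blanc2004, Xue1997,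
Bezdek2011, arXiv:1601.00145, doi:10.1007/s10998-006-0033-0]
#9 NoFoam (support) — (shared item stmt-AtomisticToContinuum-2912, a crux of
BenjaminiSchrammGroundStates; DERIVED here by ExposedCostGivesNoFoam) there is r₀ > 0 such that for
every R > 0 and every sequence of LJ ground states x^N, the fraction of particles i for which some
point c with |c − x_i| ≤ R has no particle within distance r₀ tends to 0. [difficulty: M]
[BlancLewin2015, LastPenrose2017]
#9 CrysEnergyLimit (support) — (shared item stmt-AtomisticToContinuum-0626, bookkeeping:
periodisation 0715 + trial states 0629 + BlancLewin2015_8_holds) E(N)/N → ⨅ over periodic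
configurations of the LJ energy per particle; the only place a_N = E(N) − Ne* = o(N) enters.
[difficulty: M] [BlancLewin2015]
#9 ExposedCostGivesNoFoam (support) — (glue, card Σ3/C1) ExposedSitesCost → (E(N)/N → ⨅_Q e(Q)) →
NoFoam: with r₀ from ExposedSitesCost and c = c(R), for a ground-state sequence 0 ≤ #exposed_N/N ≤
(E(N)/N − e*)/c → 0 (squeeze; the two exposure predicates are syntactically the same). [difficulty:
provable-now] [BlancLewin2015]
#9 SurfaceTensionPositive (support) — (card Σ4, the headline σ_LJ > 0 in effective form) there is c
> 0 with N·⨅_Q e(Q) + c·N^{2/3} ≤ E(N) for every N (N = 0, 1 are harmless: E(0) = E(1) = 0 and e* <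
0). A shared target for cards one-grain-sbv-window, excess-decay-epsilon-regularity,
hull-exactification-cascade, kossel-squeeze-surface-relations; derived here from ExposedSitesCost,
provable directly by any other means. [difficulty: open-problem] [BlancLewin2015, arXiv:1904.06169,
arXiv:1601.00145, HeitmannRadin1980]
#9 ExposedCostGivesTension (support) — (glue) ExposedSitesCost → SurfaceTensionPositive: take R = r₀
and a ground state for each N (LennardJonesGroundStatesExist_holds); by
LennardJonesMinimalDistance_holds (δ = 1/3) a δ-separated N-point set has ≥ c₁N^{2/3} particles
touching an empty r₀-ball — Loomis–Whitney: one coordinate shadow of ∪B(x_i, δ/2) has area ≥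
c(Nδ³)^{2/3}; slide a ball of radius r₀ down each vertical line of an s-grid through the shadow: its
first contact is an exposed particle, and each particle is charged by ≤ π(r₀ + s)²/s² lines.
[difficulty: M] [BlancLewin2015, doi:10.1090/S0002-9904-1949-09320-5]
#9 ReflectionDoubling (support) — (card Rung 1, provable now) for every injective N-configuration x
in ℝ³, unit vector u and ε ≥ 0: E(2N) ≤ 2·𝓔(x) + m_ε(u)·V_LJ(1 + 2ε), where m_ε(u) = #{i : ⟨x_j, u⟩
≤ ⟨x_i, u⟩ + ε for all j} is the population of the depth-ε cap in direction u. Proof: X' =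
(reflection of x in its supporting plane ⟨·, u⟩ = h) + u; cross distances are √(|Δ⊥|² + (1 + t_i +
t_j)²) ≥ 1 (t = depth below the plane), so the union is injective, every cross term is ≤ 0
(lennardJones_nonpos) and particle i faces its own image at distance 1 + 2t_i where V_LJ is
increasing; E(2N) ≤ 𝓔(x ∪ X') (interactionEnergy_append, isometry invariance). With E(2N) ≥ 2N·e_∞
(BlancLewin2015_8_holds) and x a ground state: E(N) − N·e_∞ ≥ ½|V_LJ(1 + 2ε)|·max_u m_ε(u), e.g. ≥
0.034 × (largest 0.05-facet population) — faceted ground states have a_N ≍ N^{2/3}. [difficulty: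
provable-now] [BlancLewin2015,
Literature.MathematicalPhysics.StatisticalMechanics.interactionEnergy_append,
Literature.MathematicalPhysics.StatisticalMechanics.lennardJones_nonpos]
#9 GroundStatesChargePeriodic (support) — (shared item stmt-AtomisticToContinuum-2911, crux 3 of
BenjaminiSchrammGroundStates; here the hinge produced by BSLimitGlue) for every sequence of LJ
ground states there is ONE periodic configuration Q such that for all R, ε > 0 there is ρ > 0 with,
for infinitely many N, at least ρN particles whose R-neighbourhood is ε-matched both ways with x_i +
A(Q.points − q) for some linear isometry A and base point q ∈ Q.points. [difficulty: XL]
[BlancLewin2015, AldousSteele2004]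
#9 ChargedPeriodicIsOptimal (support) — (shared item stmt-AtomisticToContinuum-2913,
surgery-attainment) a periodic configuration charged with positive density at every scale by some
sequence of LJ ground states has the least energy per particle among periodic configurations (excise
charged R-patches, insert patches of a competitor Q', compare with E(N')/N' → e_∞ and trial states).
[difficulty: M] [BlancLewin2015, AldousSteele2004]
#9 BSLimitGlue (support) — (shared item stmt-AtomisticToContinuum-2915, the Benjamini–Schramm
framework) StationaryMinimisersChargePeriodic → NoFoam → (E(N)/N → ⨅_Q e(Q)) →
GroundStatesChargePeriodic: rooted empirical fields, tightness from the hard core, exact mass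
transport at finite N, NoFoam ⇒ a.s. relative density ⇒ Palm inversion to a stationary law with the
hypotheses of the bulk crux, portmanteau back to finite N. [difficulty: L] [AldousLyons2007,
AldousSteele2004, BenjaminiSchramm1996, HevelingLast2005, LastThorisson2009, LastPenrose2017]
#9 ChargedPatternCrystallizes (support) — (shared item stmt-AtomisticToContinuum-2916, soft)
GroundStatesChargePeriodic → LennardJonesMinimalDistance → IsCrystallizing lennardJones 3 (scales
(k, 1/k), good particles, O(3)-compactness of the isometries,
PeriodicConfiguration.tendsto_sum_of_eventually_near'). [difficulty: M] [BlancLewin2015]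

TWO-LAYER PLAN. Foreseen split 1 (once VoidWallDeficit or a refuter's kit census moves):
ExposedSitesCost ⇐ VoidWallDeficitAtScale (every particle within R
of an empty r₀-ball lies within R + r₀ of a ball-TOUCHING particle, and touching particles have
half-bond deficit ≥ γ/2: VoidWallDeficit +
packing) → SheetSurplusControl (the card's slab certificate: in a ground state the total
over-binding surplus Σ_i (e* − ½𝓔ⁱ)₊ is at most
(γ/2 − c)·#touching; by the sub-ball bound Σ_{i∈W}(e* − ½𝓔ⁱ) ≤ ½|I(W, Wᶜ)| ≤ C R² surplus is
surface-like at every scale, so only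
sheet-organised Z ≥ 13 environments between two half-crystal charges matter) → ExposedSitesCost;
glue = the half-bond identity
2𝓔 = Σ_i 𝓔ⁱ (two_mul_interactionEnergy, in tree). Foreseen split 2:
StationaryMinimisersChargePeriodic exactly as planned in route
BenjaminiSchrammGroundStates (LocalBarlowAlmostSurely → ZeroFaultDensity), shared there. Nothing
filed now.

KILL CRITERIA. ExposedSitesCost refuted as typed (a ground-state family whose vacuum-adjacent count
exceeds (E(N) − Ne*)/c for every c: sponge-like or
over-bound-sheet minimisers) closes the route `refuted:ExposedSitesCost` — and puts NoFoam (2912)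
itself in doubt for every cohesion-first
line. VoidWallDeficit refuted (a ground state with a void-wall or hull particle binding within every
γ of 2|e*|) kills Rung 2 and split 1 but
not the route: restate with the void radius 1 replaced by a larger r₁ (half-space limit) —
ReflectionDoubling and the glue survive anything.
StationaryMinimisersChargePeriodic refuted closes this route together with
BenjaminiSchrammGroundStates (same item): re-attach the surface
half (ExposedSitesCost, NoFoam glue, σ > 0) to whichever bulk route survives, since cohesion is
route-independent. A "refutation" of
SurfaceTensionPositive can only be a typing slip (junk ⨅ if CrysPeriodicBddBelow 0714 failed) —
physics has σ_LJ > 0. Mooted-by: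
LjDefectCoercivity (3505) or KeplerBound (3102) plus a surface clause proved elsewhere implies
ExposedSitesCost outright; NoFoam proved
directly leaves the assembly alive and the route's own content reduced to σ > 0 and the rungs.

NOT DECOMPOSED YET. The gauge / slab-certificate format of SheetSurplusControl and its constants
(B_half, the Z = 13/14 trap slack, L6/L12 of hcp — card
margin-map-one-centre-traps); the quantitative minimal distance (≥ 0.9) that VoidWallDeficit wants —
to be vendored as a cite fact
(Yuhjtman2015 gives 0.684 in r₀ = 1 units) or improved; the surface window from above a_N ≤
C·N^{2/3} (blocks of regularised near-optimal
periodic configurations), needed only for bisection cohesion |I(A,B)| ≥ 2a_{N/2} − a_N and diam =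
O(N^{1/3}), which are NOT filed;
vacancy exclusion (adatom field ≤ 2|e*| − γ versus the binding ≈ 1.3–1.43 of a relaxed vacancy site:
certified lattice numerics); the
card's steep-Mie (2p, p) test-bed (Σ6); the Benjamini–Schramm internals (BSLimitGlue stays one
shared support item). All are layer-2
children or `--supports` helper lemmas, later.

CHEAPEST FALSIFIER. For VoidWallDeficit / ExposedSitesCost together: over the putative LJ global
minima N ≤ 1000 (Cambridge Cluster Database: Mackay
icosahedra, Marks decahedra, fcc/truncated octahedra at N = 38, the Leary tetrahedron 98, 102–104)
tabulate (a) the maximal binding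
β_i = −𝓔ⁱ of particles touching an empty unit ball and (b) the ratio (𝓔(x) − N·e(hcp))/#exposed(r₀ =
R = 1). The cruxes predict
max β ≤ 1.435 − γ with γ ≳ 0.15 and a ratio floor ≳ 0.2 uniformly in N; one cluster with a void-wall
particle at β ≥ 1.40, or a ratio
drifting to 0 with N, retires the line (a refuter's kit job; not run here — compute-free hub, no job
submitted at open). ReflectionDoubling
cannot fail (three lines of algebra, checked by hand above). Lookup already done: no printed lower
bound E(N) − Ne* ≥ cN^{2/3} or
vacancy-exclusion theorem for 3-D LJ (card audits ×3 + searches below; d = 1 only: arXiv:1904.06169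
Prop 3.4).

NUMBERS. V_LJ = r⁻¹²/12 − r⁻⁶/6, V(1) = −1/12; e* ≈ −8.61/12 = −0.7175, bulk cohesive sum 2|e*| ≈
1.435 = 12 unit bonds + 0.435 tail
(Stillinger2001 lattice sums; hcp below fcc by ≈ 1e-4 relative); hull/facet binding ≈ 1.0–1.1 (9
bonds + half tail), kink site = |e*|
exactly (Kossel half-crystal position); Z = 13/14 one-centre over-binding slack 1–3 % (card
margin-map-one-centre-traps, uncertified);
reflection constant ½|V_LJ(1.1)| = 0.034; minimal distance in ground states: proved ≥ 1/3 (tree,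
LennardJonesMinimalDistance_holds), ≥ 0.684
(= 0.7678σ, Yuhjtman2015 via KiesslingWales2025 p. 4), observed minimum 0.903 at N = 923,
conjectured > 0.891 (KiesslingWales2025 pp. 2, 6);
largest hole of fcc/hcp at a* ≈ 0.971: 0.69 (octahedral) < 1 = the void radius of VoidWallDeficit;
empty tangent unit ball ⇒ empty 60° cap
for neighbours at distance ≤ 1 (cos θ ≤ r/2); sticky analogue: contacts ≤ 6N − 0.926N^{2/3}
(Bezdek–Reid, arXiv:1601.00145 Thm (i)), i.e.
σ_sticky ≥ 0.926 bonds; putative LJ cluster energies E(N) ≈ N·e* + b·N^{2/3} with b ≈ 1.2 in tree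
units (icosahedral / decahedral fits,
Doye2000), so the expected c(r₀ = R = 1) is ≈ 0.25. Items at open: 14 (3 cruxes, 10 support, 1
assembly).

DEFINITION REQUESTS. None needed to elaborate: exposure, void walls and cap populations are inlined
over dist / inner / Nat.card; siteEnergy, IsGroundState,
groundStateEnergy, PeriodicConfiguration.energyPerParticle, LennardJonesMinimalDistance exist
(Crystallization.lean, LennardJonesClusters.lean).
Cite fact wanted later (not filed now): the quantitative minimal distance in LJ ground states
(Yuhjtman2015: r_min ≥ 0.7678σ = 0.684 r₀)
as a named fact of Literature/MathematicalPhysics/StatisticalMechanics for VoidWallDeficit provers.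

Novelty: Searches (2026-08-15): `lit search --source crossref "surface energy Lennard-Jones clusters lower
bound ground state"` (9: Blanc2004,
Doye–Miller–Wales 1999 doi:10.1063/1.480217, Šiber 2004; nothing bounding E(N) − Ne* from below);
`lit search --source zbmath "Lennard-Jones
clusters minimal interatomic distance"` (3: Schachinger–Addis–Bomze–Schoen 2007
doi:10.1007/s10589-007-9051-y, Locatelli–Schoen 2002, Vinkó
2005) and `"minimal distance Lennard-Jones clusters" --reviews` (5: + KiesslingWales2025 =
arXiv:2511.15008, READ pp. 2, 4, 6, 9–10: best
proved r_min ≥ 0.7678σ, conjecture r_min > σ, Bezdek–Reid bound quoted); `lit search --source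
crossref "one-sided kissing number Hadwiger
sphere half-space"` (8: Musin 2006 doi:10.1007/s10998-006-0033-0); `lit read arxiv:1504.01153 --grep
'minimal distance|surface'` (§2.2 p. 7:
the minimal-distance literature; no surface-order lower bound anywhere in the review); `lit galaxy
search "surface energy of Lennard-Jones
clusters" --star all` (0 rows; panama/pdf stars timed out); the local FTS/hybrid tier and the arXiv
API were unavailable this session
(searchd connection reset, HTTP 429) — recorded in NOTES.md. Plus the card's three refuter novelty
audits of 2026-08-15 (65 works citing
FlatleyTheil2015 swept; JKST arXiv:1904.06169 Prop 3.4 read p. 11; Bezdek–Khan arXiv:1601.00145 Thm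
(i) read p. 6), the 14 route files of the
sub-problem as of 11:21Z and its 110 cards: no route states σ > 0, ExposedSitesCost or
VoidWallDeficit; OneGrainWind  [refs: 10.1063/1.480217, 10.1007/s10589-007-9051-y, 10.1007/s10998-006-0033-0, 2511.15008, 1504.01153, 1904.06169, 1601.00145, doi:10.1063/1.480217, doi:10.1007/s10589-007-9051-y, doi:10.1007/s10998-006-0033-0, arxiv:1504.01153, Blanc2004, KiesslingWales2025, FlatleyTheil2015, HeitmannRadin1980, AuYeungFrieseckeSchmidt2012, FriedrichKreutz2023, Xue1997, Yuhjtman2015, BlancLewin2015]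

Barriers (technique_class: surface-tension one-particle-moves slab-certificate): - technique_class: surface-tension one-particle-moves slab-certificate
- Literature.Barriers.AtomisticToContinuum.IcosahedralClusters: applies to any finite-N structural
claim; none is made — Mackay icosahedra are faceted (ReflectionDoubling gives a_N ≍ N^{2/3} for
them), compact and all surface-priced, consistent with every item; LJ₁₃ pays (E(13) − 13e*)/13 ≈
0.43 per (exposed) particle (IcosahedralClusters_holds numbers).
- Literature.Barriers.AtomisticToContinuum.StickySphereClusters: same; small-N degeneracy is
invisible to ∃c-statements and to a liminf; in the sticky limit ExposedSitesCost is Bezdek–Reid's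
theorem.
- Literature.Barriers.AtomisticToContinuum.TetrahedralFrustration: APPLIES to any proof of
ExposedSitesCost in the form of Z ≥ 13 over-binding; not evaded but relocated — by the sub-ball
bound surplus is surface-like at every scale, so only sheet-organised frustration between two bulk
charges matters; the bet is that such sheets cannot carry positive surplus density against the ≥
0.17 half-bond deficit of exposed sites. VoidWallDeficit evades it by margin (the empty 60° cap
costs ≈ 17 % ≫ 3 % trap slack).
- Literature.Barriers.AtomisticToContinuum.KissingTwelveDegeneracy: not met — no shell inference, no
stacking statement; every Barlow half-crystal has the same σ to leading order.
- Literature.Barriers.AtomisticToContinuum.ShortRangeStackingBlindness: not met by the statements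
(stacking-blind by design); it bites a PROOF of ExposedSitesCost through any trunca

History (route lifecycle, newest last):
- 2026-08-15T13:47:15Z · CLOSED retired — not-a-thesis: assembly does not conclude the sub-problem Statement (operator:999:1257524)

sub-problem: Crystallization · status: closed(retired) · opened planner-plancard-AtomisticToContinuum-Crystal-2c2c210b-0 2026-08-15T11:40:37Z · rev 0 · ledger route-AtomisticToContinuum-SurfaceTensionFirst
GENERATED by the gate from the ledger (D-0016/17). Provers cite these decls: `theorem foo : Summit.AtomisticToContinuum.Crystallization.Theses.SurfaceTensionFirst.<Decl> := …` in Summits/AtomisticToContinuum/Crystallization/Theorems/<Name>.lean.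
-/

namespace Summit.AtomisticToContinuum.Crystallization.Theses.SurfaceTensionFirst

open scoped BigOperators Topology Manifold Classical MeasureTheory ProbabilityTheory Matrix InnerProductSpace ComplexConjugate ContinuousMap
open Filter Set Function TopologicalSpace MeasureTheory

attribute [summit_statement] _root_.Crystallization

/-- item stmt-AtomisticToContinuum-5287 · crux · rank 2 · closed · moot by None · by planner
why it might fail: Physically true (σ_LJ > 0) but any lower-bound method must be exact at e* in the bulk: a stacking-blind gauge loses ηN ≫ N^{2/3} (e(fcc) − e(hcp) ≈ 1e-4·|e*|), and Z ≥ 13 over-binding sheets (slack 1–3 %) may offset the ≈ 0.17 half-bond deficit of exposed sites.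
sources: BlancLewin2015, Theil2006, AuYeungFrieseckeSchmidt2012, FriedrichKreutz2023, arXiv:1904.06169, arXiv:1601.00145
[crux] (card Σ4/Σ5, configuration form, for ground states) there is r₀ > 0 such that for every R > 0
some c > 0 satisfies, for every N and every N-particle Lennard-Jones ground state x in ℝ³: c·#{i :
some point p with |p − x_i| ≤ R has no particle strictly within distance r₀} ≤ E(N) − N·⨅_Q e(Q).
Vacuum-adjacent particles (outer surface, internal voids and cracks of radius ≥ r₀) each cost c
above the periodic infimum; no minimiser is named, no stability modulus and no stacking resolution
appear in the statement (contrast LjDefectCoercivity 3505, KeplerBound 3102). For R < r₀ the set is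
empty and the statement is periodisation 0715. [difficulty: open-problem] -/
@[route_item "route-AtomisticToContinuum-SurfaceTensionFirst"]
def ExposedSitesCost : Prop :=
  ∃ r₀ : ℝ, 0 < r₀ ∧ ∀ R : ℝ, 0 < R → ∃ c : ℝ, 0 < c ∧ ∀ (N : ℕ) (x : Fin N → EuclideanSpace ℝ (Fin 3)), Literature.MathematicalPhysics.StatisticalMechanics.IsGroundState Literature.MathematicalPhysics.StatisticalMechanics.lennardJones x → c * (Nat.card {i : Fin N // ∃ p : EuclideanSpace ℝ (Fin 3), dist p (x i) ≤ R ∧ ∀ j : Fin N, r₀ ≤ dist p (x j)} : ℝ) ≤ Literature.MathematicalPhysics.StatisticalMechanics.groundStateEnergy Literature.MathematicalPhysics.StatisticalMechanics.lennardJones 3 N - (N : ℝ) * (⨅ Q : Literature.MathematicalPhysics.StatisticalMechanics.PeriodicConfiguration 3, Q.energyPerParticle Literature.MathematicalPhysics.StatisticalMechanics.lennardJones)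

/-- item stmt-AtomisticToContinuum-2910 · crux · rank 3 · closed · moot by None · by planner
why it might fail: Potential-generic versions are false (AperiodicTilingGroundStates; Radin 1986 two-species quasiperiodic minimisers; Sütő). For LJ an amorphous/polytetrahedral or aperiodically stacked stationary law reaching e* kills it; the stacking half rests on Hägg domination (J₂≈−7e−5, uncertified, item 0670).
sources: Radin1991, RadinSchulman1983, Radin1987, BlancLewin2015, Lewin2022, Leble2016
[crux] (card item (iii)/A4, stationary form) for all δ₀, r₀ > 0 and every probability law P on
counting measures μ of ℝ³ that is (a) a.s. a sum of unit Dirac masses on a δ₀-separated set, (b)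
a.s. r₀-relatively dense (every ball of radius r₀ contains a point), (c) translation invariant, and
(d) energy-minimal in the Campbell form E Σ_(x ∈ μ ∩ B̄(0,1)) Σ_(y ∈ μ, y ≠ x) V_LJ(|x − y|) = 2 · E
μ(B̄(0,1)) · ⨅_Q e(Q), there is a periodic configuration Q such that for all R, ε > 0, with positive
P-probability some translate of μ is ε-matched both ways with Q on the ball of radius R. Ergodicity
is deliberately not assumed (equivalent modulo ergodic decomposition; the natural "defect density
costs energy" proofs work for stationary laws directly). [difficulty: open-problem] -/
@[route_item "route-AtomisticToContinuum-SurfaceTensionFirst"]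
def StationaryMinimisersChargePeriodic : Prop :=
  ∀ δ₀ r₀ : ℝ, 0 < δ₀ → 0 < r₀ → ∀ P : MeasureTheory.Measure (MeasureTheory.Measure (EuclideanSpace ℝ (Fin 3))), MeasureTheory.IsProbabilityMeasure P → (∀ᵐ μ ∂P, ∃ S : Set (EuclideanSpace ℝ (Fin 3)), (∀ x ∈ S, ∀ y ∈ S, x ≠ y → δ₀ ≤ dist x y) ∧ μ = MeasureTheory.Measure.sum (fun s : S => MeasureTheory.Measure.dirac (s : EuclideanSpace ℝ (Fin 3)))) → (∀ᵐ μ ∂P, ∀ c : EuclideanSpace ℝ (Fin 3), ∃ y : EuclideanSpace ℝ (Fin 3), μ {y} ≠ 0 ∧ dist y c ≤ r₀) → (∀ (v : EuclideanSpace ℝ (Fin 3)) (A : Set (MeasureTheory.Measure (EuclideanSpace ℝ (Fin 3)))), MeasurableSet A → P {μ | μ.map (· + v) ∈ A} = P A) → (∫ μ, (∑' p : {p : EuclideanSpace ℝ (Fin 3) × EuclideanSpace ℝ (Fin 3) // μ {p.1} ≠ 0 ∧ μ {p.2} ≠ 0 ∧ p.1 ∈ Metric.closedBall (0 : EuclideanSpace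 ℝ (Fin 3)) 1 ∧ p.1 ≠ p.2}, Literature.MathematicalPhysics.StatisticalMechanics.lennardJones (dist p.1.1 p.1.2)) ∂P) = 2 * (∫ μ, (μ (Metric.closedBall (0 : EuclideanSpace ℝ (Fin 3)) 1)).toReal ∂P) * (⨅ Q : Literature.MathematicalPhysics.StatisticalMechanics.PeriodicConfiguration 3, Q.energyPerParticle Literature.MathematicalPhysics.StatisticalMechanics.lennardJones) → ∃ Q : Literature.MathematicalPhysics.StatisticalMechanics.PeriodicConfiguration 3, ∀ R ε : ℝ, 0 < R → 0 < ε → 0 < P {μ | ∃ v : EuclideanSpace ℝ (Fin 3), (∀ s ∈ Q.points, dist s 0 ≤ R → ∃ y : EuclideanSpace ℝ (Fin 3), μ {y} ≠ 0 ∧ dist y (s + v) ≤ ε) ∧ (∀ y : EuclideanSpace ℝ (Fin 3), μ {y} ≠ 0 → dist y v ≤ R → ∃ s ∈ Q.points, dist y (s + v) ≤ ε)}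

/-- item stmt-AtomisticToContinuum-5288 · crux · rank 4 · closed · moot by None · by planner
why it might fail: Needs a near-sharp minimal distance in ground states (proved 0.684 r₀ = 0.7678σ, Yuhjtman2015; conjectured 0.891, KiesslingWales2025) and a certified cap-excluded one-centre maximum < 1.435 (estimated 1.1–1.25, never computed); volume counting alone allows > 30 near neighbours.
sources: Yuhjtman2015, KiesslingWales2025, Blanc2004, Xue1997, Bezdek2011, arXiv:1601.00145
[crux] (card Rung 2 / Σ2, the exposed half of ExposedSitesCost in the half-bond gauge) there is γ >
0 such that in every Lennard-Jones ground state every particle x_i on the wall of an empty open unit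
ball (some p with |p − x_i| ≤ 1 and |p − x_j| ≥ 1 for all j; every convex-hull particle qualifies
with p = x_i + outward unit normal) has site energy Σ_{k≠i} V_LJ(|x_i − x_k|) ≥ 2·⨅_Q e(Q) + γ, i.e.
binds by a uniform margin less than the bulk cohesive sum 2|e*| ≈ 1.435. The empty ball removes a
60° cap (≈ 3 of 12 first neighbours, ≈ 17 % of the binding, against ≤ 3 % one-centre over-binding
slack); by one-particle relocation it bounds the adatom field of every ground state by 2|e*| − γ +
1/12 everywhere (no deep re-entrant sites; vacancy exclusion once L6/L12 numerics are certified).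
[difficulty: L] -/
@[route_item "route-AtomisticToContinuum-SurfaceTensionFirst"]
def VoidWallDeficit : Prop :=
  ∃ γ : ℝ, 0 < γ ∧ ∀ (N : ℕ) (x : Fin N → EuclideanSpace ℝ (Fin 3)), Literature.MathematicalPhysics.StatisticalMechanics.IsGroundState Literature.MathematicalPhysics.StatisticalMechanics.lennardJones x → ∀ i : Fin N, (∃ p : EuclideanSpace ℝ (Fin 3), dist p (x i) ≤ 1 ∧ ∀ j : Fin N, 1 ≤ dist p (x j)) → 2 * (⨅ Q : Literature.MathematicalPhysics.StatisticalMechanics.PeriodicConfiguration 3, Q.energyPerParticle Literature.MathematicalPhysics.StatisticalMechanics.lennardJones) + γ ≤ Literature.MathematicalPhysics.StatisticalMechanics.siteEnergy Literature.MathematicalPhysics.StatisticalMechanics.lennardJones x i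

/-- item stmt-AtomisticToContinuum-0626 · support · rank 9 · open · by planner
sources: BlancLewin2015
Energetic crystallization: E(N)/N converges to the infimum over periodic (multi-lattice)
configurations of the LJ energy per particle in d = 3. Lower bound liminf ≥ ⨅ is the content ((a)
local optimality + (d) + surface term O(N^{2/3})); upper bound is filed separately. -/
@[route_item "route-AtomisticToContinuum-SurfaceTensionFirst"]
def CrysEnergyLimit : Prop :=
  Filter.Tendsto (fun N : ℕ => Literature.MathematicalPhysics.StatisticalMechanics.groundStateEnergy Literature.MathematicalPhysics.StatisticalMechanics.lennardJones 3 N / N) Filter.atTop (nhds (⨅ Q : Literature.MathematicalPhysics.StatisticalMechanics.PeriodicConfiguration 3, Q.energyPerParticle Literature.MathematicalPhysics.StatisticalMechanics.lennardJones))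

/-- item stmt-AtomisticToContinuum-2911 · support · rank 9 · open · by planner
sources: BlancLewin2015, AldousSteele2004
[crux] (finite-N hinge; deterministic shadow of "the Benjamini–Schramm limit of the ground states
charges Q") for every sequence of LJ ground states x^N in ℝ³ there is ONE periodic configuration Q
such that for all R, ε > 0 there is ρ > 0 with, for infinitely many N, at least ρN particles i whose
R-neighbourhood x^N ∩ B_R(x_i) is ε-matched both ways with x_i + A(Q.points − q) for some linear
isometry A and some base point q ∈ Q.points (base point in Q.points, not a fixed origin: no
vertex-transitivity is forced, cf. refuter note on 0751). Weaker than BulkDefectVanish 0751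
(fraction → 1, fixed HCP): positive density, frequently in N, any periodic Q. [deps:
StationaryMinimisersChargePeriodic, NoFoam] [difficulty: XL] -/
@[route_item "route-AtomisticToContinuum-SurfaceTensionFirst"]
def GroundStatesChargePeriodic : Prop :=
  ∀ x : (N : ℕ) → (Fin N → EuclideanSpace ℝ (Fin 3)), (∀ N, Literature.MathematicalPhysics.StatisticalMechanics.IsGroundState Literature.MathematicalPhysics.StatisticalMechanics.lennardJones (x N)) → ∃ Q : Literature.MathematicalPhysics.StatisticalMechanics.PeriodicConfiguration 3, ∀ R ε : ℝ, 0 < R → 0 < ε → ∃ ρ : ℝ, 0 < ρ ∧ ∃ᶠ N : ℕ in Filter.atTop, ρ * (N : ℝ) ≤ (Nat.card {i : Fin N // ∃ A : EuclideanSpace ℝ (Fin 3) →ₗᵢ[ℝ] EuclideanSpace ℝ (Fin 3), ∃ q ∈ Q.points, (∀ s ∈ Q.points, dist s q ≤ R → ∃ j : Fin N, dist (x N j) (x N i + A (s - q)) ≤ ε) ∧ (∀ j : Fin N, dist (x N j) (x N i) ≤ R → ∃ s ∈ Q.points, dist (x N j) (x N i + A (s - q)) ≤ ε)} : ℝ)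

/-- item stmt-AtomisticToContinuum-2912 · support · rank 9 · closed · moot by None · by planner
sources: BlancLewin2015, LastPenrose2017
[crux] (card item A1, cohesion) there is r₀ > 0 such that for every R > 0 and every sequence of LJ
ground states x^N, the fraction of particles i for which some point c with |c − x_i| ≤ R has no
particle within distance r₀ tends to 0 as N → ∞. Equivalently every Benjamini–Schramm limit is a.s.
r₀-relatively dense (bounded Voronoi cells), hence the Palm law of a stationary process with
intensity ≥ 1/|B_(r₀)| — the one finite-N input of the line. Mechanism available: exchange of the
least-bound particle (site energy h_max) with a wall position of an interior void (site energy ≤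
−k/12 for k contacts), plus deformation (closing a crack gains tail energy ∝ area). [difficulty: L] -/
@[route_item "route-AtomisticToContinuum-SurfaceTensionFirst"]
def NoFoam : Prop :=
  ∃ r₀ : ℝ, 0 < r₀ ∧ ∀ R : ℝ, 0 < R → ∀ x : (N : ℕ) → (Fin N → EuclideanSpace ℝ (Fin 3)), (∀ N, Literature.MathematicalPhysics.StatisticalMechanics.IsGroundState Literature.MathematicalPhysics.StatisticalMechanics.lennardJones (x N)) → Filter.Tendsto (fun N : ℕ => (Nat.card {i : Fin N // ∃ c : EuclideanSpace ℝ (Fin 3), dist c (x N i) ≤ R ∧ ∀ j : Fin N, r₀ ≤ dist c (x N j)} : ℝ) / N) Filter.atTop (nhds 0)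

/-- item stmt-AtomisticToContinuum-2913 · support · rank 9 · open · by planner
sources: BlancLewin2015, AldousSteele2004
[support] (card item A3, SURGERY-ATTAINMENT; conjunct (i) from a support statement) if a periodic
configuration Q is charged by some sequence of LJ ground states with positive density at every scale
(the conclusion of GroundStatesChargePeriodic for this Q), then e(Q) is the least value of the
energy per particle over all periodic configurations. Proof sketch: if e(Q') < e(Q), pick R ≫
1/(e(Q) − e(Q')) and ε small; along the infinitely many N with ≥ ρN good particles select ≥ ρN/(C
R³) disjoint good R-balls (hard-core packing bound, in tree), excise each patch (n ≈ |Q ∩ B_R|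
particles, self-energy ≥ n e(Q) − Cεn − CR², cross terms ≥ −CR² by the r⁻⁶ tail and
LennardJonesMinimalDistance) and insert a Q'-patch of radius R − 1 with n' ≤ n particles (margin 1 ⇒
all new cross terms ≤ 0); compare E(N') ≤ E_mod with E(M)/M → e_∞ (BlancLewin2015_8_holds, proved)
and e_∞ ≤ e(Q') (trial states, 0629): 0 ≤ k[(n' − n)(e(Q') − e_∞) − n(e(Q) − e(Q')) + CR² + Cεn] +
o(N) with k ≥ cρN/R³ is absurd for R large. No Wulff shapes, no rates. [difficulty: M] -/
@[route_item "route-AtomisticToContinuum-SurfaceTensionFirst"]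
def ChargedPeriodicIsOptimal : Prop :=
  ∀ Q : Literature.MathematicalPhysics.StatisticalMechanics.PeriodicConfiguration 3, (∃ x : (N : ℕ) → (Fin N → EuclideanSpace ℝ (Fin 3)), (∀ N, Literature.MathematicalPhysics.StatisticalMechanics.IsGroundState Literature.MathematicalPhysics.StatisticalMechanics.lennardJones (x N)) ∧ ∀ R ε : ℝ, 0 < R → 0 < ε → ∃ ρ : ℝ, 0 < ρ ∧ ∃ᶠ N : ℕ in Filter.atTop, ρ * (N : ℝ) ≤ (Nat.card {i : Fin N // ∃ A : EuclideanSpace ℝ (Fin 3) →ₗᵢ[ℝ] EuclideanSpace ℝ (Fin 3), ∃ q ∈ Q.points, (∀ s ∈ Q.points, dist s q ≤ R → ∃ j : Fin N, dist (x N j) (x N i + A (s - q)) ≤ ε) ∧ (∀ j : Fin N, dist (x N j) (x N i) ≤ R → ∃ s ∈ Q.points, dist (x N j) (x N i + A (s - q)) ≤ ε)} : ℝ)) → IsLeast (Set.range fun Q' : Literature.MathematicalPhysics.StatisticalMechanics.PeriodicConfiguration 3 => Q'.energyPerParticle Literature.MathematicalPhysics.StatisticalMechanics.lennardJones) (Q.energyPerParticle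 Literature.MathematicalPhysics.StatisticalMechanics.lennardJones)

/-- item stmt-AtomisticToContinuum-2915 · support · rank 9 · closed · moot by None · by planner
sources: AldousLyons2007, AldousSteele2004, BenjaminiSchramm1996, HevelingLast2005, LastThorisson2009, LastPenrose2017
[support] (the Benjamini–Schramm framework, glue of the foreseen split of
GroundStatesChargePeriodic) StationaryMinimisersChargePeriodic → NoFoam → (E(N)/N → ⨅_Q e(Q)) →
GroundStatesChargePeriodic. Proof sketch: rooted empirical fields P_N = N⁻¹ Σ_i δ_(x^N − x_i) as
laws on counting measures; hard core δ (LennardJonesMinimalDistance_holds) ⇒ tightness/compactness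
in the vague topology; h(μ) = ½ Σ_(y ≠ 0) V(|y|) is bounded continuous there, so E_P[h] = lim
E(N_j)/N_j = ⨅ e for every subsequential limit P; P is point-stationary (mass transport holds
identically at finite N); NoFoam ⇒ P-a.s. r₀-dense ⇒ Palm inversion gives a stationary probability
law with the hypotheses (a)–(d) of the rank-2 crux (Campbell); its charged Q has P_(N_j)-frequency ≥
ρ for j large (portmanteau on open pattern events), which is the hinge. [glue] [difficulty: L] -/
@[route_item "route-AtomisticToContinuum-SurfaceTensionFirst"]
def BSLimitGlue : Prop :=
  StationaryMinimisersChargePeriodic → NoFoam → Filter.Tendsto (fun N : ℕ => Literature.MathematicalPhysics.StatisticalMechanics.groundStateEnergy Literature.MathematicalPhysics.StatisticalMechanics.lennardJones 3 N / N) Filter.atTop (nhds (⨅ Q : Literature.MathematicalPhysics.StatisticalMechanics.PeriodicConfiguration 3, Q.energyPerParticle Literature.MathematicalPhysics.StatisticalMechanics.lennardJones)) → GroundStatesChargePeriodic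

/-- item stmt-AtomisticToContinuum-2916 · support · rank 9 · open · by planner
sources: BlancLewin2015
[support] (soft) GroundStatesChargePeriodic → LennardJonesMinimalDistance → IsCrystallizing
lennardJones 3: choose scales (k, 1/k), indices N_k ↑ with a good particle i_k, isometries A_k → A
along a subsequence (compactness of O(3)), τ_k := −x_(i_k) + alignment; the two-way matching with
minimal distance is eventually exact near every compact set, so
PeriodicConfiguration.tendsto_sum_of_eventually_near' (in tree) gives local convergence to the
periodic configuration A(Q − q) (isometryImage/translate in CrystallizationSymmetries), multiplicity
1. [difficulty: M] -/
@[route_item "route-AtomisticToContinuum-SurfaceTensionFirst"]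
def ChargedPatternCrystallizes : Prop :=
  GroundStatesChargePeriodic → Literature.MathematicalPhysics.StatisticalMechanics.LennardJonesMinimalDistance → Literature.MathematicalPhysics.StatisticalMechanics.IsCrystallizing Literature.MathematicalPhysics.StatisticalMechanics.lennardJones 3

/-- item stmt-AtomisticToContinuum-5289 · support · rank 9 · closed · moot by None · by planner
sources: BlancLewin2015
[support] (glue, card Σ3/C1) ExposedSitesCost → (E(N)/N → ⨅_Q e(Q)) → NoFoam: with r₀ from
ExposedSitesCost and c = c(R), for a ground-state sequence 0 ≤ #exposed_N/N ≤ (E(N)/N − e*)/c → 0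
(squeeze; the two exposure predicates are syntactically the same). [difficulty: provable-now] -/
@[route_item "route-AtomisticToContinuum-SurfaceTensionFirst"]
def ExposedCostGivesNoFoam : Prop :=
  ExposedSitesCost → CrysEnergyLimit → NoFoam

/-- item stmt-AtomisticToContinuum-5290 · support · rank 9 · closed · moot by None · by planner
sources: BlancLewin2015, arXiv:1904.06169, arXiv:1601.00145, HeitmannRadin1980
[support] (card Σ4, the headline σ_LJ > 0 in effective form) there is c > 0 with N·⨅_Q e(Q) +
c·N^{2/3} ≤ E(N) for every N (N = 0, 1 are harmless: E(0) = E(1) = 0 and e* < 0). A shared target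
for cards one-grain-sbv-window, excess-decay-epsilon-regularity, hull-exactification-cascade,
kossel-squeeze-surface-relations; derived here from ExposedSitesCost, provable directly by any other
means. [difficulty: open-problem] -/
@[route_item "route-AtomisticToContinuum-SurfaceTensionFirst"]
def SurfaceTensionPositive : Prop :=
  ∃ c : ℝ, 0 < c ∧ ∀ N : ℕ, (N : ℝ) * (⨅ Q : Literature.MathematicalPhysics.StatisticalMechanics.PeriodicConfiguration 3, Q.energyPerParticle Literature.MathematicalPhysics.StatisticalMechanics.lennardJones) + c * (N : ℝ) ^ (2 / 3 : ℝ) ≤ Literature.MathematicalPhysics.StatisticalMechanics.groundStateEnergy Literature.MathematicalPhysics.StatisticalMechanics.lennardJones 3 N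

/-- item stmt-AtomisticToContinuum-5291 · support · rank 9 · closed · moot by None · by planner
sources: BlancLewin2015, doi:10.1090/S0002-9904-1949-09320-5
[support] (glue) ExposedSitesCost → SurfaceTensionPositive: take R = r₀ and a ground state for each
N (LennardJonesGroundStatesExist_holds); by LennardJonesMinimalDistance_holds (δ = 1/3) a
δ-separated N-point set has ≥ c₁N^{2/3} particles touching an empty r₀-ball — Loomis–Whitney: one
coordinate shadow of ∪B(x_i, δ/2) has area ≥ c(Nδ³)^{2/3}; slide a ball of radius r₀ down each
vertical line of an s-grid through the shadow: its first contact is an exposed particle, and each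
particle is charged by ≤ π(r₀ + s)²/s² lines. [difficulty: M] -/
@[route_item "route-AtomisticToContinuum-SurfaceTensionFirst"]
def ExposedCostGivesTension : Prop :=
  ExposedSitesCost → SurfaceTensionPositive

/-- item stmt-AtomisticToContinuum-5292 · support · rank 9 · closed · moot by None · by planner
sources: BlancLewin2015, Literature.MathematicalPhysics.StatisticalMechanics.interactionEnergy_append, Literature.MathematicalPhysics.StatisticalMechanics.lennardJones_nonpos
[support] (card Rung 1, provable now) for every injective N-configuration x in ℝ³, unit vector u and
ε ≥ 0: E(2N) ≤ 2·𝓔(x) + m_ε(u)·V_LJ(1 + 2ε), where m_ε(u) = #{i : ⟨x_j, u⟩ ≤ ⟨x_i, u⟩ + ε for all j}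
is the population of the depth-ε cap in direction u. Proof: X' = (reflection of x in its supporting
plane ⟨·, u⟩ = h) + u; cross distances are √(|Δ⊥|² + (1 + t_i + t_j)²) ≥ 1 (t = depth below the
plane), so the union is injective, every cross term is ≤ 0 (lennardJones_nonpos) and particle i
faces its own image at distance 1 + 2t_i where V_LJ is increasing; E(2N) ≤ 𝓔(x ∪ X')
(interactionEnergy_append, isometry invariance). With E(2N) ≥ 2N·e_∞ (BlancLewin2015_8_holds) and x
a ground state: E(N) − N·e_∞ ≥ ½|V_LJ(1 + 2ε)|·max_u m_ε(u), e.g. ≥ 0.034 × (largest 0.05-facet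
population) — faceted ground states have a_N ≍ N^{2/3}. [difficulty: provable-now] -/
@[route_item "route-AtomisticToContinuum-SurfaceTensionFirst"]
def ReflectionDoubling : Prop :=
  ∀ (N : ℕ) (x : Fin N → EuclideanSpace ℝ (Fin 3)), Function.Injective x → ∀ (u : EuclideanSpace ℝ (Fin 3)), ‖u‖ = 1 → ∀ ε : ℝ, 0 ≤ ε → Literature.MathematicalPhysics.StatisticalMechanics.groundStateEnergy Literature.MathematicalPhysics.StatisticalMechanics.lennardJones 3 (2 * N) ≤ 2 * Literature.MathematicalPhysics.StatisticalMechanics.interactionEnergy Literature.MathematicalPhysics.StatisticalMechanics.lennardJones x + (Nat.card {i : Fin N // ∀ j : Fin N, inner ℝ (x j) u ≤ inner ℝ (x i) u + ε} : ℝ) * Literature.MathematicalPhysics.StatisticalMechanics.lennardJones (1 + 2 * ε)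

/-- item stmt-AtomisticToContinuum-5293 · assembly · rank 1 · closed · moot by None · by planner
sources: BlancLewin2015, AldousSteele2004
[assembly] ExposedSitesCost → ExposedCostGivesNoFoam → StationaryMinimisersChargePeriodic →
ChargedPeriodicIsOptimal → BSLimitGlue → ChargedPatternCrystallizes → CrysEnergyLimit →
Crystallization (LJ, d = 3). -/
@[route_item "route-AtomisticToContinuum-SurfaceTensionFirst"]
def Assembly : Prop :=
  ExposedSitesCost → ExposedCostGivesNoFoam → StationaryMinimisersChargePeriodic → ChargedPeriodicIsOptimal → BSLimitGlue → ChargedPatternCrystallizes → CrysEnergyLimit → Literature.MathematicalPhysics.StatisticalMechanics.Crystallization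

end Summit.AtomisticToContinuum.Crystallization.Theses.SurfaceTensionFirst
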